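import Summits.QuantumFields.YangMills.Theorems.BalabanLadderNTMirrorHankel
import HarnessLib

/-!
# Crux `NT` (stmt-QuantumFields-19353): the mirror sequence is a positive-semidefinite HANKEL kernel (both parities)

Helper file (`--supports stmt-QuantumFields-19353`) of the fleet lead prover of crux `NT` (unit `ym-spine-19353-p1`,
g10), hypothesis-free; completes `…NTMirrorHankel`, which extracted the `1 × 1` and `2 × 2` principal minors
(positivity, log-convexity).  Here the full quadratic forms: on the odd torus of side `2S+1` (`S ≥ 1`, `β ≥ 0`, compact
`G`, continuous unitary `ρ`, any `d`), for a bounded measurable real observable `F` of the slab `0 ≤ t ≤ T` and its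
mirror sequence `q(n) = Cov_T(F∘ϑ, F_n)`, and ANY real coefficients `c₀, …, c_m`:

* **`hankel_even_psd`**: `0 ≤ Σ_{s,t ≤ m} c_s c_t · q(s+t)` whenever `T + m ≤ S` — site-reflection positivity of the
  linear combination `Σ_s c_s F_s` (all translates in the closed non-negative half);
* **`hankel_odd_psd`**: `0 ≤ Σ_{s,t ≤ m} c_s c_t · q(s+t+1)` whenever `T + m + 1 ≤ S` — LINK-reflection positivity of
  `Σ_s c_s F_{s+1}` (using `F_{s+1}∘Θ = F_s∘ϑ`).

So `(q(s+t))_{s,t}` and its shift `(q(s+t+1))_{s,t}` are both positive semidefinite: on every finite odd torus the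
floor currency of clause (i) / (MF) is, lag by lag, a truncated STIELTJES moment sequence — the exact finite-volume
content of the transfer-matrix formula `q(n) = ⟨F̂Ω, T^n F̂Ω⟩ − |⟨Ω,F̂Ω⟩|²` with `0 ≤ T ≤ 1` (which it does not use).
Bookkeeping lemmas: `dependsOn_finset_sum_smul`, `integral_sum_mul_sum` (bilinear expansion under Wilson's measure).

Refs: K. Osterwalder, E. Seiler, Ann. Phys. 110 (1978) 440, §2; J. Glimm, A. Jaffe, *Quantum Physics* (1987) §6.1;
N. I. Akhiezer, *The classical moment problem* (1965) Ch. 2 (Hankel / Stieltjes positivity) — cited for the reading only.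
-/

set_option autoImplicit false

noncomputable section

open MeasureTheory Finset
open Literature.MathematicalPhysics.QuantumFieldTheory
open Literature.MathematicalPhysics.QuantumFieldTheory.WilsonRP
open Literature.MathematicalPhysics.QuantumFieldTheory.WilsonOddRP
open Literature.MathematicalPhysics.QuantumFieldTheory.WilsonSiteRP
open Literature.MathematicalPhysics.QuantumFieldTheory.WilsonNegRP
open Summit.QuantumFields.YangMills.Cruxes.NT.Reflection

namespace Summit.QuantumFields.YangMills.Cruxes.NT.MirrorHankel

variable {d L N : ℕ} [NeZero d] [NeZero L]
variable {G : Type*} [Group G] [TopologicalSpace G] [IsTopologicalGroup G] [CompactSpace G]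
  [MeasurableSpace G] [BorelSpace G] (ρ : G →* Matrix (Fin N) (Fin N) ℂ)

/-! ## §1 Bookkeeping: linear combinations of slab observables -/

omit [TopologicalSpace G] [IsTopologicalGroup G] [CompactSpace G] [BorelSpace G] [Group G] [MeasurableSpace G]
  [NeZero d] [NeZero L] in
/-- A finite linear combination of observables of a link set is an observable of that link set. [folklore] -/
theorem dependsOn_finset_sum_smul {ι : Type*} (R : Finset ι) (c : ι → ℝ) {A : Set (Edge d L)}
    {g : ι → GaugeConfig d L G → ℝ} (h : ∀ i ∈ R, DependsOn (g i) A) :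
    DependsOn (fun U => ∑ i ∈ R, c i * g i U) A :=
  fun _ _ hUV => Finset.sum_congr rfl fun i hi => by rw [h i hi hUV]

omit [TopologicalSpace G] [IsTopologicalGroup G] [CompactSpace G] [BorelSpace G] [Group G] [NeZero d] [NeZero L] in
/-- A finite linear combination of bounded measurable observables is bounded and measurable. [folklore] -/
theorem measurable_bdd_finset_sum_smul {ι : Type*} (R : Finset ι) (c : ι → ℝ) {g : ι → GaugeConfig d L G → ℝ}
    (hm : ∀ i ∈ R, Measurable (g i)) {K : ℝ} (hb : ∀ i ∈ R, ∀ U, |g i U| ≤ K) :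
    Measurable (fun U => ∑ i ∈ R, c i * g i U) ∧ ∃ K' : ℝ, ∀ U, |∑ i ∈ R, c i * g i U| ≤ K' := by
  refine ⟨Finset.measurable_sum R fun i hi => (hm i hi).const_mul (c i), ⟨∑ i ∈ R, |c i| * K, fun U => ?_⟩⟩
  refine (abs_sum_le_sum_abs _ _).trans (sum_le_sum fun i hi => ?_)
  rw [abs_mul]
  exact mul_le_mul_of_nonneg_left (hb i hi U) (abs_nonneg _)

omit [NeZero d] in
/-- **Bilinear expansion under Wilson's measure**: for bounded measurable `g_i`, `h_j`,
`∫ (Σ_i c_i g_i)(Σ_j c_j h_j) dμ = Σ_i Σ_j c_i c_j ∫ g_i h_j dμ`. [folklore] -/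
theorem integral_sum_mul_sum (hρ : Continuous ρ) (β : ℝ) {ι : Type*} (R : Finset ι) (c : ι → ℝ)
    {g h : ι → GaugeConfig d L G → ℝ} (hgm : ∀ i ∈ R, Measurable (g i)) (hhm : ∀ i ∈ R, Measurable (h i))
    {K : ℝ} (hgb : ∀ i ∈ R, ∀ U, |g i U| ≤ K) (hhb : ∀ i ∈ R, ∀ U, |h i U| ≤ K) :
    ∫ U, (∑ i ∈ R, c i * g i U) * (∑ j ∈ R, c j * h j U) ∂(wilsonMeasure ρ β) =
      ∑ i ∈ R, ∑ j ∈ R, c i * c j * ∫ U, g i U * h j U ∂(wilsonMeasure ρ β) := by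
  have hint : ∀ i ∈ R, ∀ j ∈ R, Integrable (fun U => c i * c j * (g i U * h j U)) (wilsonMeasure ρ β) := by
    intro i hi j hj
    refine (integrable_wilson_of_bdd ρ hρ β ((hgm i hi).mul (hhm j hj)) ⟨K * K, fun U => ?_⟩).const_mul _
    rw [Pi.mul_apply, abs_mul]
    exact mul_le_mul (hgb i hi U) (hhb j hj U) (abs_nonneg _) ((abs_nonneg _).trans (hgb i hi U))
  have hpt : ∀ U : GaugeConfig d L G, (∑ i ∈ R, c i * g i U) * (∑ j ∈ R, c j * h j U) =
      ∑ i ∈ R, ∑ j ∈ R, c i * c j * (g i U * h j U) := fun U => by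
    rw [Finset.sum_mul_sum]
    exact sum_congr rfl fun i _ => sum_congr rfl fun j _ => by ring
  simp_rw [hpt]
  rw [integral_finsetSum R fun i hi => integrable_finsetSum R fun j hj => hint i hi j hj]
  refine sum_congr rfl fun i hi => ?_
  rw [integral_finsetSum R fun j hj => hint i hi j hj]
  refine sum_congr rfl fun j _ => ?_
  rw [integral_const_mul]

/-! ## §2 The two Hankel forms -/

/-- **Even Hankel positivity (site reflection)**: `0 ≤ Σ_{s,t ≤ m} c_s c_t q(s+t)` for `T + m ≤ S` — reflection
positivity of `ϑ` applied to `Σ_s c_s F_s`. [cite: OsterwalderSeiler1978, §2] -/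
theorem hankel_even_psd {S : ℕ} (hL : L = 2 * S + 1) (hS : 1 ≤ S) (hρ : Continuous ρ) {β : ℝ} (hβ : 0 ≤ β)
    {F : GaugeConfig d L G → ℝ} (hFm : Measurable F) {K : ℝ} (hK : ∀ U, |F U| ≤ K) {T : ℕ}
    (hFdep : DependsOn F (slab (d := d) (L := L) 0 T)) (c : ℕ → ℝ) {m : ℕ} (hm : T + m ≤ S) :
    0 ≤ ∑ s ∈ range (m + 1), ∑ t ∈ range (m + 1), c s * c t * mirrorSeq ρ β F (s + t) := by
  set R := range (m + 1) with hR
  have hmem : ∀ s ∈ R, s ≤ m := fun s hs => Nat.lt_succ_iff.mp (mem_range.mp hs)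
  -- the linear combination of translates is a bounded measurable observable of the non-negative half
  have hgm : ∀ s ∈ R, Measurable (timeShift s F) := fun s _ => measurable_timeShift hFm s
  have hgb : ∀ s ∈ R, ∀ U, |timeShift s F U| ≤ K := fun s _ U => hK _
  obtain ⟨hHm, hHb⟩ := measurable_bdd_finset_sum_smul R c hgm hgb
  have hHdep : DependsOn (fun U => ∑ s ∈ R, c s * timeShift s F U)
      {e : Edge d L | (e.1 0).val ≤ S ∧ ((e.1.shift e.2) 0).val ≤ S} :=
    dependsOn_finset_sum_smul R c fun s hs =>
      (dependsOn_timeShift hFdep (n := s) (by have := hmem s hs; omega)).mono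
        (slab_subset_posHalf (by have := hmem s hs; omega))
  have h0 := cov_negReflect_self_nonneg_odd_pos ρ hL hS hρ hβ hHm hHb hHdep
  -- expand the two integrals
  have hϑm : Measurable (GaugeConfig.negReflect : GaugeConfig d L G → GaugeConfig d L G) := measurable_negReflect
  have e1 := integral_sum_mul_sum ρ hρ β R c (g := fun s U => timeShift s F U.negReflect) (h := fun t => timeShift t F)
    (fun s hs => (hgm s hs).comp hϑm) hgm (fun s hs U => hgb s hs _) hgb
  have e2 : ∫ U, ∑ s ∈ R, c s * timeShift s F U ∂(wilsonMeasure ρ β) =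
      (∑ s ∈ R, c s) * ∫ U, F U ∂(wilsonMeasure ρ β) := by
    rw [integral_finsetSum R fun s hs => (integrable_wilson_of_bdd ρ hρ β (hgm s hs) ⟨K, hgb s hs⟩).const_mul _,
      Finset.sum_mul]
    exact sum_congr rfl fun s _ => by rw [integral_const_mul, integral_timeShift]
  rw [e1, e2] at h0
  -- identify the quadratic form
  have e3 : ((∑ s ∈ R, c s) * ∫ U, F U ∂(wilsonMeasure ρ β)) ^ 2 =
      ∑ s ∈ R, ∑ t ∈ R, c s * c t * (∫ U, F U ∂(wilsonMeasure ρ β)) ^ 2 := by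
    rw [mul_pow, sq (∑ s ∈ R, c s), Finset.sum_mul_sum, Finset.sum_mul]
    exact sum_congr rfl fun s _ => by rw [Finset.sum_mul]
  rw [e3, ← Finset.sum_sub_distrib] at h0
  refine h0.trans_eq (sum_congr rfl fun s _ => ?_)
  rw [← Finset.sum_sub_distrib]
  refine sum_congr rfl fun t _ => ?_
  rw [mirrorSeq_eq, ← integral_negReflect_timeShift_mul_timeShift]
  ring

/-- **Odd Hankel positivity (link reflection)**: `0 ≤ Σ_{s,t ≤ m} c_s c_t q(s+t+1)` for `T + m + 1 ≤ S` — reflection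
positivity of `Θ` applied to `Σ_s c_s F_{s+1}`, with `F_{t+1}∘Θ = F_t∘ϑ`. [cite: OsterwalderSeiler1978, §2] -/
theorem hankel_odd_psd {S : ℕ} (hL : L = 2 * S + 1) (hS : 1 ≤ S) (hρ : Continuous ρ) {β : ℝ} (hβ : 0 ≤ β)
    {F : GaugeConfig d L G → ℝ} (hFm : Measurable F) {K : ℝ} (hK : ∀ U, |F U| ≤ K) {T : ℕ}
    (hFdep : DependsOn F (slab (d := d) (L := L) 0 T)) (c : ℕ → ℝ) {m : ℕ} (hm : T + m + 1 ≤ S) :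
    0 ≤ ∑ s ∈ range (m + 1), ∑ t ∈ range (m + 1), c s * c t * mirrorSeq ρ β F (s + t + 1) := by
  have hodd : Odd L := ⟨S, hL⟩
  have hL3 : 3 ≤ L := by omega
  set R := range (m + 1) with hR
  have hmem : ∀ s ∈ R, s ≤ m := fun s hs => Nat.lt_succ_iff.mp (mem_range.mp hs)
  have hgm : ∀ s ∈ R, Measurable (timeShift (s + 1) F) := fun s _ => measurable_timeShift hFm (s + 1)
  have hgb : ∀ s ∈ R, ∀ U, |timeShift (s + 1) F U| ≤ K := fun s _ U => hK _
  obtain ⟨hHm, hHb⟩ := measurable_bdd_finset_sum_smul R c hgm hgb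
  have hHdep : DependsOn (fun U => ∑ s ∈ R, c s * timeShift (s + 1) F U)
      ((oPosEdges ∪ oSharedEdges : Finset (Edge d L)) : Set (Edge d L)) :=
    dependsOn_finset_sum_smul R c fun s hs =>
      (dependsOn_timeShift hFdep (n := s + 1) (by have := hmem s hs; omega)).mono
        (slab_subset_oPos (d := d) hL (by omega) (by have := hmem s hs; omega))
  have h0 := cov_timeReflect_self_nonneg_odd ρ hodd hL3 hρ hβ hHm hHb hHdep
  -- `H∘Θ = Σ c_t F_t∘ϑ`
  have hΘ : ∀ U : GaugeConfig d L G, (∑ t ∈ R, c t * timeShift (t + 1) F U.timeReflect) =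
      ∑ t ∈ R, c t * timeShift t F U.negReflect := fun U =>
    sum_congr rfl fun t _ => by rw [timeShift_succ_timeReflect]
  simp only [hΘ] at h0
  have hϑm : Measurable (GaugeConfig.negReflect : GaugeConfig d L G → GaugeConfig d L G) := measurable_negReflect
  have e1 := integral_sum_mul_sum ρ hρ β R c (g := fun s => timeShift (s + 1) F)
    (h := fun t U => timeShift t F U.negReflect) hgm (fun t _ => (measurable_timeShift hFm t).comp hϑm) hgb
    (fun t _ U => hK _)
  have e2 : ∫ U, ∑ s ∈ R, c s * timeShift (s + 1) F U ∂(wilsonMeasure ρ β) =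
      (∑ s ∈ R, c s) * ∫ U, F U ∂(wilsonMeasure ρ β) := by
    rw [integral_finsetSum R fun s hs => (integrable_wilson_of_bdd ρ hρ β (hgm s hs) ⟨K, hgb s hs⟩).const_mul _,
      Finset.sum_mul]
    exact sum_congr rfl fun s _ => by rw [integral_const_mul, integral_timeShift]
  rw [e1, e2] at h0
  have e3 : ((∑ s ∈ R, c s) * ∫ U, F U ∂(wilsonMeasure ρ β)) ^ 2 =
      ∑ s ∈ R, ∑ t ∈ R, c s * c t * (∫ U, F U ∂(wilsonMeasure ρ β)) ^ 2 := by
    rw [mul_pow, sq (∑ s ∈ R, c s), Finset.sum_mul_sum, Finset.sum_mul]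
    exact sum_congr rfl fun s _ => by rw [Finset.sum_mul]
  rw [e3, ← Finset.sum_sub_distrib] at h0
  refine h0.trans_eq (sum_congr rfl fun s _ => ?_)
  rw [← Finset.sum_sub_distrib]
  refine sum_congr rfl fun t _ => ?_
  -- `∫ F_{s+1} · F_t∘ϑ = ∫ F_t∘ϑ · F_{s+1} = ∫ F∘ϑ · F_{s+t+1}`
  have hcomm : ∫ U, timeShift (s + 1) F U * timeShift t F U.negReflect ∂(wilsonMeasure ρ β) =
      ∫ U, timeShift t F U.negReflect * timeShift (s + 1) F U ∂(wilsonMeasure ρ β) :=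
    integral_congr_ae (ae_of_all _ fun U => mul_comm _ _)
  rw [hcomm, integral_negReflect_timeShift_mul_timeShift, mirrorSeq_eq, show t + (s + 1) = s + t + 1 by ring]
  ring

end Summit.QuantumFields.YangMills.Cruxes.NT.MirrorHankel

end
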